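import Summits.BirchSwinnertonDyer.BirchSwinnertonDyer.Theorems.Rank1ResidualX11RankOneCore
import Summits.BirchSwinnertonDyer.BirchSwinnertonDyer.Theorems.Rank1ResidualX11RankOneSurj
import HarnessLib

/-!
# BSD rank-≤1 residual cell, class X11 ∧ r = 1 ∧ ¬sst ∧ p ≥ 5: the FINAL headline —
# ten published facts + three numbers per pair ⟹ `BSD(E,p)` for all 85 residue pairs (N < 2·10⁴)

HONEST FRAMING (cell `b2b-bsdres-*`, verbatim): prove what is provable now; shrink each hard class
to its core with data; no claim beyond stated classes; COMBINATION classes deleted from PUBLISHED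
theorems only, CONSTRUCTION-shaped remainder typed; this is not "finishing BSD". Class X11b stays
CONSTRUCTION-SHAPED; everything here is PER PAIR; no lane verdict is changed; no named fact.

Theorems only. `Rank1ResidualX11RankOneCore.lean` left ONE Galois-theoretic hypothesis in the
core claim: `Surj r.curve r.p` for the 11 records without a (ram) witness (`ram_nil_exactly`). Their
records carry Serre witnesses `(ℓᵢ, a_{ℓᵢ})` (Serre 1972 §2.8 Prop. 19), re-verified numerically
by `Record.check`; here they become KERNEL THEOREMS through the generic
`IntModel.hasSurjectiveModNGaloisRep_of_intModel_of_serreWitnesses` (Prop. 19, the frame of §5.2,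
the Frobenius trace on `E[p]`, `χ̄_p(Frob_ℓ) = ℓ` — all tree theorems; file
`Rank1ResidualX11RankOneSurj.lean`, theorem `surj_of_mem_of_ram_nil`). This file:

* **`bsdp_of_published_of_threeNumbers`** — the FINAL headline of unit `b2b-bsdres-x11c`: the ten
  published named facts (Kato–Wuthrich surjective divisibility, Skinner 2016 Thm. A, Stein–Wuthrich
  2013 Thm. 6.1 ×2, SW §4.2 height existence ×2, Wuthrich 2014 Prop. 21, Gross–Zagier–Kolyvagin,
  modularity ×2) and, per record, ONLY the three engine numbers — analytic rank `= 1`, `#Ш_an` as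
  recorded (`= 1`), and the two-engine `p`-adic valuation identity (`CertSplit` / `CertNonsplit`) —
  give Miller's `BSD(E,p)` for every one of the 85 residue pairs of X11 ∧ r = 1 ∧ ¬sst ∧ p ≥ 5,
  `N < 2·10⁴`. Every other hypothesis about the curves (`p` prime, `Δ ≠ 0`, global minimality,
  multiplicative reduction at `p`, split type, non-semistability, the (ram) witness, `E[p]`
  irreducible, `ρ̄_{E,p}` onto where needed) is verified by the kernel.

References: J.-P. Serre, Invent. Math. 15 (1972) §2.8 Prop. 19, §5.2 [Serre1972]; Skinner 2016
Thm. A [Skinner2016PacificMC]; Stein–Wuthrich 2013 [SteinWuthrich2013]; Wuthrich 2014 [Wuthrich2014];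
Mazur–Tate–Teitelbaum 1986 [MazurTateTeitelbaum1986Invent]; Cremona's tables [Cremona2006].
-/

set_option linter.dupNamespace false
set_option autoImplicit false

noncomputable section

open scoped Classical MatrixGroups ModularForm

open CongruenceSubgroup WeierstrassCurve Literature.NumberTheory.EllipticCurves
  Literature.NumberTheory.EllipticCurves.ModularForms
  Literature.NumberTheory.EllipticCurves.Rank1Residual
  Literature.NumberTheory.EllipticCurves.Rank1Residual.Typed
  Literature.NumberTheory.EllipticCurves.Skinner2016
  Literature.NumberTheory.EllipticCurves.Wuthrich2014
  Literature.NumberTheory.EllipticCurves.SteinWuthrich2013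
  Literature.NumberTheory.EllipticCurves.Rank1Residual.X11RankOneCertificates
  Summit.BirchSwinnertonDyer.BirchSwinnertonDyer.Rank1Residual.IntModel

namespace Summit.BirchSwinnertonDyer.BirchSwinnertonDyer.Rank1Residual.X11RankOne

/-! ### §4. The final headline: ten published facts + three numbers per pair -/

/-- **FINAL HEADLINE of unit `b2b-bsdres-x11c` — `BSD(E,p)` for all 85 residue pairs of
X11 ∧ r = 1 ∧ ¬sst ∧ p ≥ 5 (`N < 2·10⁴`) from the TEN published named facts and THREE NUMBERS per
pair.** Hypotheses: Kato–Wuthrich surjective divisibility `hK`, Skinner 2016 Thm. A `hA`,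
Stein–Wuthrich 2013 Thm. 6.1 `hJs`/`hJn`, SW §4.2 height existence `hHs`/`hHn`, Wuthrich 2014
Prop. 21 `hW`, Gross–Zagier–Kolyvagin `hGZK`, modularity `hmod`/`hpar` (all published; MTT
non-split existence and everything else PROVED); and per record: analytic rank `= 1`, `#Ш_an` as
recorded, the `p`-adic certificate (`CertSplit`/`CertNonsplit`: `ord_T L_p = r + e` and the
valuation identity, PARI + msengine). Primality, non-singularity, global minimality (Silverman/Kraus),
`Mult`, split type, `¬sst`, (ram), `Irr` (Frobenius witness, Mazur 6.3(1)) and `Surj` for the 11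
(ram)-free pairs (Serre witnesses, Prop. 19) are kernel theorems. Per pair; class label unchanged.
[cite: Skinner2016PacificMC, Thm. A] [cite: SteinWuthrich2013, Thm. 6.1 (p. 20) and §4.2]
[cite: Wuthrich2014, Thm. 3 (p. 383), Cor. 19 (p. 398), Prop. 21 (p. 400)] [cite: Serre1972, §2.8 Prop. 19]
[cite: Mazur1978, §6 Prop. 6.3 (1) (p. 153)] [cite: MazurTateTeitelbaum1986Invent, §I.10–I.14 and §II.10] -/
theorem bsdp_of_published_of_threeNumbers
    (hK : kato_charIdeal_dvd_multiplicative_of_surjective) (hA : thmA_charIdeal_multiplicative)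
    (hJs : thm61_splitMultiplicative) (hJn : thm61_nonsplitMultiplicative)
    (hHs : exists_isSplitMultCanonical) (hHn : exists_isMultCanonical)
    (hW : Wuthrich2014.sha_dvd_analyticSha) (hGZK : rank_eq_analyticRank_of_analyticRank_le_one)
    (hmod : hasEntireLFunction_rat) (hpar : nonempty_modularParametrizationData)
    (hnum : ∀ r ∈ records1 ++ records2,
      ∀ [Fact r.p.Prime] [r.curve.IsElliptic] [r.curve.IsGloballyMinimal],
        r.curve.analyticRank = 1 ∧
        Literature.NumberTheory.EllipticCurves.shaAn r.curve = ((r.shaAn : ℚ) : ℂ) ∧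
        (r.split = true → r.CertSplit) ∧ (r.split = false → r.CertNonsplit))
    (r : Record) (hr : r ∈ records1 ++ records2) : BSDp r.curve r.p := by
  refine bsdp_of_published_of_coreClaims hK hA hJs hJn hHs hHn hW hGZK hmod hpar
    (fun r' hr' _ _ _ ↦ ?_) r hr
  obtain ⟨hran, hsha, hcs, hcn⟩ := hnum r' hr'
  exact ⟨hran, fun h0 ↦ surj_of_mem_of_ram_nil r' hr' h0, hsha, hcs, hcn⟩

end Summit.BirchSwinnertonDyer.BirchSwinnertonDyer.Rank1Residual.X11RankOne

end
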